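import Summits.HodgeConjecture.CorCM.MumfordTateRankSixCMRank
import Summits.HodgeConjecture.CorCM.MumfordTateRankSixHodge
import Summits.HodgeConjecture.CorCM.MumfordTateRankThree
import Summits.HodgeConjecture.CorCM.Sl2IsotypicTimesNondegenerateCM
import HarnessLib

/-!
# The rungs `dim MT(H¹(X)) ≤ 6`, VII: every complex abelian variety NOT of CM type with `dim MT(H¹X) ≤ 6` is stably
# nondegenerate — the Hodge conjecture for all its powers, UNCONDITIONALLY

COR-CM (cell `pub-hodgecm2`, seat `b27` gen 38, count-neutral lane MT-RANK-SIX-CMPART; theorems only, no definition,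
no named fact).  HC_CM is NOT proved and NOT used; everything here is unconditional.

By `CorCM/MumfordTateRankSixCMRank`, a complex abelian variety `X` with `0 < dim X`, NOT of CM type, with
`dim MT(H¹X) ≤ 6` (equivalently: Hodge group of semisimple rank one with centre of dimension `≤ 2`) is isogenous to
`B^{m+1} × Z` with `B` a non-CM elliptic curve or an abelian surface with quaternionic multiplication (`Lie Hg(H¹B) = 𝔰𝔩₂`)
and `Z` of CM type with `dim MT(H¹Z) = dim MT(H¹X) − 3 ≤ 3` (or `Z = 0`).  By gen 29's rung `dim MT ≤ 3`
(`isDivisorGenerated_powSucc_of_mtRank_hodge_one_le_three`: `Z ∼ S^b`, `E₁^a × E₂^b` or `E^a`) every power of `Z` is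
divisor-generated, so Moonen–Zarhin's Thm. (3.2)(2) for the `𝔰𝔩₂`-isotypic class
(`isStablyNondegenerate_prod_of_finrank_hodgeLie_le_three_of_isOfCMType`, proved in the tree) makes `B × Z`, all mixed
powers `B^{K+1} × Z^{L+1}`, and hence `X` STABLY NONDEGENERATE:

* **`isStablyNondegenerate_of_not_isOfCMType_of_mtRank_le_six`** — `B•(X^{N+1}) = D•(X^{N+1}) ⊗ ℂ` for all `N`;
* **`hodgeConjectureFor_powSucc_of_not_isOfCMType_of_mtRank_le_six`** — the Hodge conjecture for every power `X^{N+1}`,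
  for `X` itself (`hodgeConjectureFor_of_not_isOfCMType_of_mtRank_le_six`), for the isogeny classes of the powers and for
  everything dominated by a power (abelian subvarieties, quotients);
* `isStablyNondegenerate_of_finrank_derived_eq_three_of_mtRank_le_six` — the same class described as «Hodge group of
  semisimple rank one (`dim [Lie Hg, Lie Hg] = 3`) and `dim MT(H¹X) ≤ 6`»;
* instance-free form and the class-target display `hcOnClass_not_isOfCMType_mtRank_hodge_one_le_six`.

New beyond `CorCM/MumfordTateRankFiveDivisorClasses` (gen 35, `dim MT ≤ 5`) and `CorCM/MumfordTateRankSixHodge` (gen 37,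
`dim X ≤ 4`): the full rung `dim MT(H¹X) = 6`, `Hg = SL₂ · T²` in ANY dimension — e.g. `E^{a} × S^{b}`, `Q^{a} × S^{b}`,
`E^{a} × E₁^{b} × E₂^{c}`, `Q^a × E₁^b × E₂^c` (`E` non-CM elliptic, `Q` a QM surface, `S` a simple CM surface, `E₁ ≁ E₂` CM
elliptic curves) and everything isogenous to or dominated by their powers.  With gen 29–35 the Mumford–Tate rank ladder now
reads: HC (indeed `B = D` on all powers) for EVERY complex abelian variety with `dim MT(H¹X) ≤ 6` that is not of CM type, and
for every `X` with `dim MT(H¹X) ≤ 3`; the CM rungs `4 ≤ dim MT ≤ 6` contain Weil-type degenerate cases (gen 32).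

## References

* [MoonenZarhin1999LowDim] B. Moonen, Yu. Zarhin, *Hodge classes on abelian varieties of low dimension*, Math. Ann.
  315 (1999), §2 (2.1)–(2.5), condition (D); §3 Thm. (3.2)(2) and (3.8); §5 (5.2).
* [Gordon1999HodgeAVSurvey] B. B. Gordon, *A survey of the Hodge conjecture for abelian varieties* (1999), Thm. 7.5,
  Def. 7.6, Thm. 7.6.2, §7.3.2 and 10.10.
* [vanGeemen1994HodgeAV] B. van Geemen, *An introduction to the Hodge conjecture for abelian varieties* (1994), §2.4–2.5,
  §3.6–3.7, Lemma 3.7.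
* [MumfordAV1970] D. Mumford, *Abelian Varieties* (1970), §19 Thm. 1 and p. 169.
-/

noncomputable section

open CategoryTheory CategoryTheory.Limits Module

namespace Summit.HodgeConjecture.CorCM

open Literature.AlgebraicGeometry.Motives
open Literature.AlgebraicGeometry.Motives.AbelianVariety
open Literature.AlgebraicGeometry.Motives.HodgeStructure
open Literature.AlgebraicGeometry.HodgeTheory
open Literature.AlgebraicGeometry.Milne1999 (IsOfCMType)
open Summit.HodgeConjecture.CorCM.Domination

section Main

variable [HodgeTensorFacts.{0, 0}] {X : AbelianVariety ℂ} {n : ℕ}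

/-! ## §1 `B = D` on all powers -/

/-- **EVERY complex abelian variety `X` NOT of CM type with `dim MT(H¹(X)) ≤ 6` is STABLY NONDEGENERATE**:
`B•(X^{N+1}) = D•(X^{N+1}) ⊗ ℂ` for every `N`, UNCONDITIONALLY.  `X ∼ B^{m+1} × Z` with `Lie Hg(H¹B) = 𝔰𝔩₂`
(`not_le_endAlg_and_finrank_hodgeLie_le_three_of_factor`) and `Z` of CM type with `dim MT(H¹Z) ≤ 3` or `Z = 0`
(`exists_isIsogenous_powSucc_prod_finrank_hodgeLie_of_mtRank_le_six`); the powers of `Z` are divisor-generated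
(`isDivisorGenerated_powSucc_of_mtRank_hodge_one_le_three`, resp. dimension `0`), so `B × Z` is stably nondegenerate
(Moonen–Zarhin Thm. (3.2)(2) for the `𝔰𝔩₂`-isotypic class), hence so are `B^{m+1} × Z` and `X`.
[cite: MoonenZarhin1999LowDim, §2 condition (D), §3 Thm. (3.2)(2) and (3.8)] [cite: Gordon1999HodgeAVSurvey, Thm. 7.5, Def. 7.6 and Thm. 7.6.2] -/
theorem isStablyNondegenerate_of_not_isOfCMType_of_mtRank_le_six (hX : IsSmoothProjective n X.X) (h0 : 0 < X.dim)
    (hcm : ¬ IsOfCMType X)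
    (h6 : haveI := BettiUniverse.finite hX 1
      (BettiUniverse.hodge exists_isReal_hodgeModel_holds hX 1).mtRank ≤ 6) :
    IsStablyNondegenerate X := by
  haveI := BettiUniverse.finite hX 1
  obtain ⟨B, Z, m, hBs, hB0, hB2, hBcm, hfinB, -, hZcm, hXYZ, -, -, -, -, -, hmt3⟩ :=
    exists_isIsogenous_powSucc_prod_finrank_hodgeLie_of_mtRank_le_six hX h0 hcm h6
  obtain ⟨hne, h3B⟩ := not_le_endAlg_and_finrank_hodgeLie_le_three_of_factor hBs hB0 hBcm hfinB hB2
  -- every power of the CM part is divisor-generated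
  have hZD : ∀ N : ℕ, IsDivisorGenerated (Z.powSucc N) := by
    intro N
    rcases Nat.eq_zero_or_pos Z.dim with hZ0 | hZpos
    · exact isDivisorGenerated_powSucc_of_isOfCMType_of_dim_le_three hZcm (by omega) N
    · exact isDivisorGenerated_powSucc_of_mtRank_hodge_one_le_three AbelianVariety.isSmoothProjective_holds hZpos
        (hmt3 hZpos) N
  have hBZ : IsStablyNondegenerate (B.prod Z) :=
    isStablyNondegenerate_prod_of_finrank_hodgeLie_le_three_of_isOfCMType hne h3B hZcm hZD
  have hXYZ' : IsIsogenous X ((B.powSucc m).prod (Z.powSucc 0)) := by rw [AbelianVariety.powSucc_zero]; exact hXYZ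
  exact (hBZ.powSucc_prod_powSucc m 0).of_isIsogenous hXYZ'

/-- **`B•(X^{N+1}) = D•(X^{N+1}) ⊗ ℂ`** for `X` NOT of CM type with `dim MT(H¹(X)) ≤ 6`, every `N`.
[cite: MoonenZarhin1999LowDim, §2 condition (D) and §3 Thm. (3.2)(2)] [cite: Gordon1999HodgeAVSurvey, Thm. 7.5 and Def. 7.6] -/
theorem isDivisorGenerated_powSucc_of_not_isOfCMType_of_mtRank_le_six (hX : IsSmoothProjective n X.X) (h0 : 0 < X.dim)
    (hcm : ¬ IsOfCMType X)
    (h6 : haveI := BettiUniverse.finite hX 1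
      (BettiUniverse.hodge exists_isReal_hodgeModel_holds hX 1).mtRank ≤ 6) (N : ℕ) :
    IsDivisorGenerated (X.powSucc N) :=
  isStablyNondegenerate_of_not_isOfCMType_of_mtRank_le_six hX h0 hcm h6 N

/-- **`B•(X) = D•(X) ⊗ ℂ`** for `X` NOT of CM type with `dim MT(H¹(X)) ≤ 6` (`N = 0`).
[cite: MoonenZarhin1999LowDim, §2 condition (D) and §3 Thm. (3.2)(2)] -/
theorem isDivisorGenerated_of_not_isOfCMType_of_mtRank_le_six (hX : IsSmoothProjective n X.X) (h0 : 0 < X.dim)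
    (hcm : ¬ IsOfCMType X)
    (h6 : haveI := BettiUniverse.finite hX 1
      (BettiUniverse.hodge exists_isReal_hodgeModel_holds hX 1).mtRank ≤ 6) :
    IsDivisorGenerated X :=
  (isStablyNondegenerate_of_not_isOfCMType_of_mtRank_le_six hX h0 hcm h6).isDivisorGenerated

/-- **The same class in Lie terms**: every complex abelian variety whose Hodge group has semisimple rank one
(`dim [Lie Hg(H¹X), Lie Hg(H¹X)] = 3`) and `dim MT(H¹X) ≤ 6` (i.e. centre of dimension `≤ 2`) is stably nondegenerate
(such `X` is not of CM type, `not_isOfCMType_of_finrank_derived_eq_three`).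
[cite: MoonenZarhin1999LowDim, §2 condition (D) and §3 Thm. (3.2)(2)] [cite: Gordon1999HodgeAVSurvey, Def. 7.6 and Thm. 7.6.2] -/
theorem isStablyNondegenerate_of_finrank_derived_eq_three_of_mtRank_le_six (hX : IsSmoothProjective n X.X)
    (h0 : 0 < X.dim)
    (h3 : haveI := BettiUniverse.finite hX 1
      Module.finrank ℚ ↥(Submodule.span ℚ {B | ∃ X' ∈ (BettiUniverse.hodge exists_isReal_hodgeModel_holds hX 1).hodgeLie,
        ∃ Y ∈ (BettiUniverse.hodge exists_isReal_hodgeModel_holds hX 1).hodgeLie, X' * Y - Y * X' = B}) = 3)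
    (h6 : haveI := BettiUniverse.finite hX 1
      (BettiUniverse.hodge exists_isReal_hodgeModel_holds hX 1).mtRank ≤ 6) :
    IsStablyNondegenerate X :=
  isStablyNondegenerate_of_not_isOfCMType_of_mtRank_le_six hX h0 (not_isOfCMType_of_finrank_derived_eq_three hX h3) h6

/-! ## §2 The Hodge conjecture -/

/-- **UNCONDITIONAL: the Hodge conjecture for EVERY POWER of every complex abelian variety `X` NOT of CM type with
`dim MT(H¹(X)) ≤ 6`** (Lefschetz `(1,1)` on the divisor-generated Hodge rings `B•(X^{N+1}) = D•(X^{N+1}) ⊗ ℂ`).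
New beyond `dim MT ≤ 5` (`CorCM/MumfordTateRankFiveHodge`) and `dim X ≤ 4` (`CorCM/MumfordTateRankSixHodge`): the rung
`dim MT(H¹X) = 6`, `Hg = SL₂ · T²`, in every dimension.
[cite: MoonenZarhin1999LowDim, §2 (2.1)–(2.5), condition (D) and §3 Thm. (3.2)(2)] [cite: Gordon1999HodgeAVSurvey, §7.3.2, Thm. 7.5 and 10.10] -/
theorem hodgeConjectureFor_powSucc_of_not_isOfCMType_of_mtRank_le_six (hX : IsSmoothProjective n X.X) (h0 : 0 < X.dim)
    (hcm : ¬ IsOfCMType X)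
    (h6 : haveI := BettiUniverse.finite hX 1
      (BettiUniverse.hodge exists_isReal_hodgeModel_holds hX 1).mtRank ≤ 6) (N : ℕ) :
    HodgeConjectureFor (X.powSucc N).dim (X.powSucc N).X :=
  (isStablyNondegenerate_of_not_isOfCMType_of_mtRank_le_six hX h0 hcm h6).hodgeConjectureFor_powSucc N

/-- **… in particular the Hodge conjecture for `X` itself** (`X` NOT of CM type, `dim MT(H¹(X)) ≤ 6`), UNCONDITIONALLY.
[cite: MoonenZarhin1999LowDim, §2 (2.1)–(2.5) and §3 Thm. (3.2)(2)] [cite: Gordon1999HodgeAVSurvey, Thm. 7.5 and 10.10] -/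
theorem hodgeConjectureFor_of_not_isOfCMType_of_mtRank_le_six (hX : IsSmoothProjective n X.X) (h0 : 0 < X.dim)
    (hcm : ¬ IsOfCMType X)
    (h6 : haveI := BettiUniverse.finite hX 1
      (BettiUniverse.hodge exists_isReal_hodgeModel_holds hX 1).mtRank ≤ 6) :
    HodgeConjectureFor X.dim X.X :=
  (isStablyNondegenerate_of_not_isOfCMType_of_mtRank_le_six hX h0 hcm h6).hodgeConjectureFor

/-- **The isogeny classes of the powers**: every complex abelian variety isogenous to a power of an `X` NOT of CM type with
`dim MT(H¹(X)) ≤ 6` satisfies the Hodge conjecture (van Geemen Lemma 3.7), UNCONDITIONALLY.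
[cite: vanGeemen1994HodgeAV, §3.5–3.7 Lemma 3.7] [cite: MoonenZarhin1999LowDim, §3 Thm. (3.2)(2)] -/
theorem hodgeConjectureFor_of_isIsogenous_powSucc_of_not_isOfCMType_of_mtRank_le_six (hX : IsSmoothProjective n X.X)
    (h0 : 0 < X.dim) (hcm : ¬ IsOfCMType X)
    (h6 : haveI := BettiUniverse.finite hX 1
      (BettiUniverse.hodge exists_isReal_hodgeModel_holds hX 1).mtRank ≤ 6)
    {A : AbelianVariety ℂ} {N : ℕ} (hA : A.IsIsogenous (X.powSucc N)) : HodgeConjectureFor A.dim A.X :=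
  (isStablyNondegenerate_of_not_isOfCMType_of_mtRank_le_six hX h0 hcm h6).hodgeConjectureFor_of_isIsogenous_powSucc hA

/-- **`B = D` and the Hodge conjecture for everything dominated by a power** of an `X` NOT of CM type with
`dim MT(H¹(X)) ≤ 6`: abelian subvarieties, quotients and isogeny factors of the `X^{N+1}`, UNCONDITIONALLY.
[cite: vanGeemen1994HodgeAV, §2.4–2.5 and §3.6–3.7] [cite: MumfordAV1970, §19 Thm. 1 and p. 169]
[cite: MoonenZarhin1999LowDim, §2 condition (D) and §3 Thm. (3.2)(2)] -/
theorem isDivisorGenerated_and_hodgeConjectureFor_of_avDominatedBy_powSucc_of_not_isOfCMType_of_mtRank_le_six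
    (hX : IsSmoothProjective n X.X) (h0 : 0 < X.dim) (hcm : ¬ IsOfCMType X)
    (h6 : haveI := BettiUniverse.finite hX 1
      (BettiUniverse.hodge exists_isReal_hodgeModel_holds hX 1).mtRank ≤ 6)
    {Y : AbelianVariety ℂ} {N : ℕ} (hY : AVDominatedBy Y (X.powSucc N)) :
    IsDivisorGenerated Y ∧ HodgeConjectureFor Y.dim Y.X :=
  have hD := isDivisorGenerated_of_avDominatedBy hY
    (isStablyNondegenerate_of_not_isOfCMType_of_mtRank_le_six hX h0 hcm h6 N)
  ⟨hD, hodgeConjectureFor_of_isDivisorGenerated Y hD⟩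

/-- **Semisimple rank one, centre of dimension `≤ 2`: the Hodge conjecture for all powers**, UNCONDITIONALLY — removes the
hypothesis `dim X ≤ 4` of `hodgeConjectureFor_powSucc_of_finrank_derived_eq_three_of_dim_le_four` and the conditional CM
hypothesis of `hodgeConjectureFor_powSucc_of_finrank_derived_eq_three_of_cm_powers` when `dim MT(H¹X) ≤ 6`.
[cite: MoonenZarhin1999LowDim, §2 (2.1)–(2.5) and §3 Thm. (3.2)(2)] [cite: Gordon1999HodgeAVSurvey, §7.3.2 and 10.10] -/
theorem hodgeConjectureFor_powSucc_of_finrank_derived_eq_three_of_mtRank_le_six (hX : IsSmoothProjective n X.X)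
    (h0 : 0 < X.dim)
    (h3 : haveI := BettiUniverse.finite hX 1
      Module.finrank ℚ ↥(Submodule.span ℚ {B | ∃ X' ∈ (BettiUniverse.hodge exists_isReal_hodgeModel_holds hX 1).hodgeLie,
        ∃ Y ∈ (BettiUniverse.hodge exists_isReal_hodgeModel_holds hX 1).hodgeLie, X' * Y - Y * X' = B}) = 3)
    (h6 : haveI := BettiUniverse.finite hX 1
      (BettiUniverse.hodge exists_isReal_hodgeModel_holds hX 1).mtRank ≤ 6) (N : ℕ) :
    HodgeConjectureFor (X.powSucc N).dim (X.powSucc N).X :=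
  (isStablyNondegenerate_of_finrank_derived_eq_three_of_mtRank_le_six hX h0 h3 h6).hodgeConjectureFor_powSucc N

end Main

/-! ## §3 Instance-free form and class-target display -/

section InstanceFree

open Literature.AlgebraicGeometry.Milne1999 (IsOfCMType)

/-- Instance-free form (the tensor facts discharged by `hodgeTensorFacts_holds`): **a complex abelian variety `X` NOT of CM
type with `0 < dim X` and `dim MT(H¹(X)) ≤ 6` is stably nondegenerate; every power `X^{N+1}` is divisor-generated and
satisfies the Hodge conjecture.** [cite: MoonenZarhin1999LowDim, §2 condition (D) and §3 Thm. (3.2)(2)]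
[cite: Gordon1999HodgeAVSurvey, Thm. 7.5, Def. 7.6 and 10.10] -/
theorem isStablyNondegenerate_and_hodgeConjectureFor_powSucc_of_not_isOfCMType_of_mtRank_le_six' {X : AbelianVariety ℂ}
    {n : ℕ} (hX : IsSmoothProjective n X.X) (h0 : 0 < X.dim) (hcm : ¬ IsOfCMType X)
    (h6 : haveI := BettiUniverse.finite hX 1
      @HodgeStructure.mtRank _ _ _ hodgeTensorFacts_holds.{0, 0} _ _
        (BettiUniverse.hodge exists_isReal_hodgeModel_holds hX 1) ≤ 6) (N : ℕ) :
    IsStablyNondegenerate X ∧ IsDivisorGenerated (X.powSucc N) ∧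
      HodgeConjectureFor (X.powSucc N).dim (X.powSucc N).X := by
  haveI : HodgeTensorFacts.{0, 0} := hodgeTensorFacts_holds.{0, 0}
  have h := isStablyNondegenerate_of_not_isOfCMType_of_mtRank_le_six hX h0 hcm h6
  exact ⟨h, h N, h.hodgeConjectureFor_powSucc N⟩

end InstanceFree

section ClassTargets

open Literature.AlgebraicGeometry.Milne1999 (IsOfCMType)
open Summit.HodgeConjecture.HodgeConjecture.Ring2.ClassTargets (HCOnClass)

/-- **Class-target display**: the Hodge conjecture holds on the class of complex abelian varieties `B` NOT of CM type with
`0 < dim B` and `dim MT(H¹(B)) ≤ 6` — UNCONDITIONAL. [cite: MoonenZarhin1999LowDim, §2 and §3 Thm. (3.2)(2)]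
[cite: Gordon1999HodgeAVSurvey, 7.5 and 10.10] -/
theorem hcOnClass_not_isOfCMType_mtRank_hodge_one_le_six :
    HCOnClass fun B => 0 < B.dim ∧ ¬ IsOfCMType B ∧
      @HodgeStructure.mtRank _ _ _ hodgeTensorFacts_holds.{0, 0}
          (BettiUniverse.finite (AbelianVariety.isSmoothProjective_holds (A := B)) 1) _
          (BettiUniverse.hodge exists_isReal_hodgeModel_holds (AbelianVariety.isSmoothProjective_holds (A := B)) 1) ≤ 6 :=
  fun _ ⟨h0, hcm, h6⟩ =>
    (isStablyNondegenerate_and_hodgeConjectureFor_powSucc_of_not_isOfCMType_of_mtRank_le_six'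
      AbelianVariety.isSmoothProjective_holds h0 hcm h6 0).2.2

end ClassTargets

end Summit.HodgeConjecture.CorCM

end
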